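import Literature.Topology.FourManifolds.HCobordismTheoremProofs
import Literature.Topology.FourManifolds.HCobordismLevelDeformationProof
import HarnessLib

/-!
# Milnor 1965, Thm. 8.1 Index 1): the one-point trading step from the deformation of the
# level diffeomorphism `h` alone

Topic `Literature/Topology/FourManifolds` (fact seat
`provefact-Literature.Topology.FourManifolds.Cobord-0bdd435f08`, the named fact
`Literature.Topology.FourManifolds.Cobordism.Milnor1965_trade_one_index_one` of
`HCobordismEliminationSteps.lean`: J. Milnor, *Lectures on the h-cobordism theorem* (1965),
proof of Thm. 8.1 for Index 1, PDF pp. 55–57 of the held copy — one critical point `p` of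
index `1` of a nice Morse function without index-`0` points on a simply connected cobordism
of dimension `n + 1 ≥ 5` with simply connected incoming end is traded for a new critical
point `r` of index `3`).  This file only re-assembles; no definitions, no named facts.

The tree proves the step from four rungs of Milnor's proof
(`Literature.Topology.FourManifolds.Cobordism.Milnor1965_trade_one_index_one_of_parts`,
`HCobordismTradeStep.lean`): the auxiliary pair in cancelling position (Lemmas 8.2, 8.3,
Thm. 8.4 with 5.8, Lemma 4.7), Thms. 4.1/4.2 on a slab, the First Cancellation Theorem 5.4 on
a slab, and Thm. 4.8.  Three of the four are now theorems of the tree —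
`Literature.Topology.FourManifolds.Cobordism.Milnor1965_exists_auxiliaryPair_holds`
(`HCobordismTheoremProofs.lean`),
`Literature.Topology.FourManifolds.Cobordism.Milnor1965_rearrangement_slab_holds`
(`RearrangementSlabProofs.lean`) and
`Literature.Topology.FourManifolds.Cobordism.Milnor1965_finalRearrangement_holds`
(`DisjointSpheresSlab.lean`) — and Thm. 5.4 on a slab follows from the one leaf below it that
is still a named fact, the deformation of the level diffeomorphism `h` in the general case of
Assertion 6 of its proof
(`Literature.Topology.FourManifolds.Cobordism.Milnor1965_cancellation_levelDeformation`,
`HCobordismLevelIsotopy.lean`; PDF pp. 31–32 with the local Theorem 5.6), by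
`Literature.Topology.FourManifolds.Cobordism.Milnor1965_firstCancellation_slab_of_levelDeformation`
(`HCobordismTheoremProofs.lean`).  Hence:

* `Literature.Topology.FourManifolds.Cobordism.Milnor1965_trade_one_index_one_of_levelDeformation`
  — **the trading step from the deformation leaf alone**;
* `Literature.Topology.FourManifolds.Cobordism.Milnor1965_trade_one_index_one_holds` — **the
  discharge of the named fact**: the previous theorem applied to
  `Literature.Topology.FourManifolds.Cobordism.Milnor1965_cancellation_levelDeformation_holds`
  (`HCobordismLevelDeformationProof.lean`, the general case of Assertion 6 of the proof of
  Thm. 5.4 by Milnor's local Theorem 5.6), now a theorem of the tree.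

## References

* J. Milnor, *Lectures on the h-cobordism theorem*, notes by L. Siebenmann and J. Sondow,
  Princeton Mathematical Notes (1965): Thm. 8.1 and its proof for Index 1, Lemmas 8.2, 8.3,
  Thm. 8.4 (PDF pp. 54–57); Thms. 4.1, 4.2, 4.8, Lemma 4.7 (PDF pp. 22–25); Thm. 5.4 and its
  proof, Assertion 6 (PDF pp. 27–32); Thm. 5.8 (PDF p. 34).  Held:
  `lit read book:milnornd-lectures-h-cobordism-theorem`. [MilnorHCobordism1965]
-/

noncomputable section

namespace Literature.Topology.FourManifolds

universe u

/-- **Milnor 1965, the trading of one index-`1` critical point (proof of Thm. 8.1 Index 1),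
PDF pp. 55–57) from the deformation of `h` alone**: the named fact
`Literature.Topology.FourManifolds.Cobordism.Milnor1965_trade_one_index_one` follows from
`Literature.Topology.FourManifolds.Cobordism.Milnor1965_cancellation_levelDeformation` (the
general case of Assertion 6 of the proof of Thm. 5.4, PDF pp. 31–32), by
`Cobordism.Milnor1965_trade_one_index_one_of_parts` with the auxiliary pair
(`Cobordism.Milnor1965_exists_auxiliaryPair_holds`), Thms. 4.1/4.2 on a slab
(`Cobordism.Milnor1965_rearrangement_slab_holds`) and Thm. 4.8
(`Cobordism.Milnor1965_finalRearrangement_holds`) discharged and Thm. 5.4 on a slab supplied by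
`Cobordism.Milnor1965_firstCancellation_slab_of_levelDeformation`.
[cite: MilnorHCobordism1965, proof of Thm. 8.1 Index 1 (PDF pp. 55–57), with Thm. 5.4, Assertion 6 (PDF pp. 27–32)] -/
theorem Cobordism.Milnor1965_trade_one_index_one_of_levelDeformation
    (hD : Cobordism.Milnor1965_cancellation_levelDeformation.{u}) :
    Cobordism.Milnor1965_trade_one_index_one.{u} :=
  Cobordism.Milnor1965_trade_one_index_one_of_parts
    Cobordism.Milnor1965_exists_auxiliaryPair_holds
    Cobordism.Milnor1965_rearrangement_slab_holds
    (Cobordism.Milnor1965_firstCancellation_slab_of_levelDeformation hD)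
    Cobordism.Milnor1965_finalRearrangement_holds

/-- **Milnor 1965, proof of Thm. 8.1 Index 1), the one-point trading step — discharge of
`Literature.Topology.FourManifolds.Cobordism.Milnor1965_trade_one_index_one`**: on a simply
connected cobordism `(W; V, V')` of dimension `n + 1 ≥ 5` with `V` simply connected, carrying a
nice (self-indexing) Morse function `g` without critical points of index `0`, one critical point
`p` of index `1` *can be traded for* a new critical point `r` of index `3`: there are a nice
Morse function `g'` and a point `r`, not critical for `g`, such that the critical points of `g'` are
those of `g` with `p` removed and `r` added, `r` of index `3` and the indices of the other critical
points unchanged.  This is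
`Cobordism.Milnor1965_trade_one_index_one_of_levelDeformation` — the auxiliary pair `q, r` of
Lemmas 8.2, 8.3 and Thm. 8.4 in cancelling position, the rearrangement Thms. 4.1/4.2, the First
Cancellation Theorem 5.4 cancelling `p` against `q`, and Thm. 4.8, all theorems of the tree —
applied to the discharge `Cobordism.Milnor1965_cancellation_levelDeformation_holds`
(`HCobordismLevelDeformationProof.lean`) of the last leaf, the deformation of the level
diffeomorphism `h` in the general case of Assertion 6 of the proof of Thm. 5.4.
[cite: MilnorHCobordism1965, Thm. 8.1 Index 1 and its proof (PDF pp. 54–57); proof of Thm. 5.4, Assertion 6 (PDF pp. 31–32)] -/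
theorem Cobordism.Milnor1965_trade_one_index_one_holds :
    Cobordism.Milnor1965_trade_one_index_one.{u} :=
  Cobordism.Milnor1965_trade_one_index_one_of_levelDeformation
    Cobordism.Milnor1965_cancellation_levelDeformation_holds

end Literature.Topology.FourManifolds

end
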